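/-
Copyright (c) 2026. All rights reserved.
Released under Apache 2.0 license as described in the file LICENSE.
-/
import Literature.NumberTheory.Automorphic.BrandtTraceNonEmbedding
import Literature.NumberTheory.Automorphic.BrandtMatrixDiagonal
import Literature.NumberTheory.Automorphic.DefiniteOrderUnitsNoncommutative
import Literature.NumberTheory.Automorphic.DefiniteEichlerOrdersTorsionFreeGenusDiscriminant
import Literature.NumberTheory.QuadraticForms.PadicSquares
import HarnessLib

/-!
# The trace of the Brandt matrix `T(p)` of a maximal order of the definite quaternion algebra of prime discriminant `p`:
# elements of reduced norm `p` have trace `0`, and `tr T(p) = ½ (h(-4p) + [h(-p)])` (Deuring–Eichler; Voight Prop. 30.9.2)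

[tag: quaternion_algebra] [tag: class_number] [tag: maximal_order] [tag: trace_formula]

Topic `NumberTheory/Automorphic`; THEOREMS ONLY (no definition, no named fact, no instance; net Literature debt `0`).
Lane `lit-hodgefound`, seat p12, gen 50 — third file of the TYPE NUMBER series: the arithmetic input of Deuring's type number
formula (Voight, *Quaternion Algebras*, Prop. 30.9.2), namely the count, for a Brandt setup `S = (D, O)` of type `(1, p)` (a maximal
order of `B_{p,∞}`), of the ideal classes `[I]` whose left order contains an element of reduced norm `p`, through the DIAGONAL of
the Brandt matrix at the ramified prime, `T(p)_{cc} = #{x ∈ O_L(I_c) : nrd x = p} / #O_L(I_c)^×` (Voight (30.9.4)), and Eichler's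
optimal-embedding count (the tree's `XiSetup.sum_card_traceNormSet_div_eq_sum_hw_br`, Vignéras III §5 Thm. 5.11 / Cor. 5.12):

* §1 `not_isSquare_neg_four_mul_padic` (`-4p` is not a square in `ℚ_p`: odd valuation), and a private Hensel lemma;
* §2 **`XiSetup.reducedTrace_eq_zero_of_reducedNorm_eq_prime`** — Voight's claim in the proof of Prop. 30.9.2: for `p ≥ 5`, an
  element of reduced norm `p` of an order of `D` (any setup of type `(M, p)`) has trace `0` (`t² < 4p` by definiteness; `t ≠ 0`
  would make `t² - 4p` a non-zero square mod `p`, hence a `p`-adic square by Hensel, contradicting that `B_p` is a division algebra,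
  the tree's `XiSetup.not_isSquare_padic_of_mul_self_eq`); `XiSetup.natCard_reducedNorm_eq_prime_eq_natCard_traceNormSet`
  (`{x ∈ O_L(I_c) : nrd x = p} = traceNormSet I_c 0 p`);
* §3 `mem_ellipticConductors_zero_prime_iff` (the orders through `√-p`: `ℤ[√-p]`, and `ℤ[(1+√-p)/2]` when `p ≡ 3 (mod 4)`),
  `brFactorRam_zero_prime_eq_one` (`m_p = 1`: `K = ℚ(√-p)` is ramified at `p`), `XiSetup.matrix_diag_eq_card_div_rat`,
  **`XiSetup.trace_matrix_ramified_eq_sum_hw`** (`tr T(p) = ½ Σ_f h_w(-4p/f²) m_p(f)`) and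
  **`XiSetup.trace_matrix_ramified`**: for `p ≥ 5`,
  **`tr T(p) = ½ (h_w(-4p) + [p ≡ 3 (4)] h_w(-p))`** (Voight (30.9.3)–(30.9.8), 30.9.10), `h_w` the tree's `weightedClassNumber`
  (`= h` for discriminants `< -4`).

## Sources

* J. Voight, *Quaternion Algebras*, GTM 288 (2021), Prop. 30.9.2 and its proof ((30.9.3)–(30.9.8)), 30.9.10, 41.1.3.
  [cite: Voight2021, Prop. 30.9.2 (proof), 30.9.10]
* M.-F. Vignéras, *Arithmétique des algèbres de quaternions*, LNM 800 (1980), Ch. II §3 (nombres de plongements locaux),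
  Ch. III §5 Thm. 5.11, Cor. 5.12, Ch. V §2 Prop. 2.4 (traces des matrices de Brandt). [cite: VignerasLNM800, Ch. III §5 Thm. 5.11, Cor. 5.12; Ch. V §2 Prop. 2.4]
* J.-P. Serre, *A Course in Arithmetic*, Ch. II §3.3 Thm. 3 (squares in `ℚ_p`). [cite: Serre1973, Ch. II §3.3 Thm 3]

## Scope (honest)

Theorems only. The hypothesis `p ≥ 5` is that of Voight's formula (for `p = 2, 3` elements of norm `p` need not be pure, e.g. `1 + i`
in the Hurwitz order); the trace is stated over `ℚ` for BrandtXi's `Brandt.matrix`. The identification of `½(h(-4p) + [h(-p)])`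
with `h(√-p) · (1, 4, 2)/…` by `p (mod 8)` (Voight 30.9.10) is not restated here.
-/

noncomputable section


open Finset
open scoped Pointwise

namespace Literature.NumberTheory.Automorphic

open HeckeTraceFormulaGL2Level

namespace Brandt

/-! ## §1 `p`-adic preliminaries -/

section Padic

variable {p : ℕ} [hp : Fact p.Prime]

/-- Odd `p`: an integer whose residue is a non-zero square mod `p` is a square in `ℚ_p` (Hensel, from the tree's
`padicInt_isSquare_of_toZMod_eq_one`). [cite: Serre1973, Ch. II §3.3 Thm 3] -/
private theorem padic_isSquare_intCast (hp2 : p ≠ 2) {n : ℤ} (h0 : ((n : ℤ) : ZMod p) ≠ 0)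
    (hsq : IsSquare ((n : ℤ) : ZMod p)) : IsSquare ((n : ℤ) : ℚ_[p]) := by
  obtain ⟨a, ha⟩ := hsq
  have ha0 : a ≠ 0 := fun h => h0 (by rw [ha, h, mul_zero])
  set b : ZMod p := a⁻¹ with hb
  have hab : a * b = 1 := mul_inv_cancel₀ ha0
  have hb0 : b ≠ 0 := fun h => by rw [h, mul_zero] at hab; exact zero_ne_one hab
  obtain ⟨C, hC⟩ : ∃ C : ℕ, (C : ZMod p) = b := ⟨b.val, ZMod.natCast_zmod_val b⟩
  have hC0 : C ≠ 0 := fun h => hb0 (by rw [← hC, h, Nat.cast_zero])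
  set u : ℤ_[p] := (n : ℤ_[p]) * (C : ℤ_[p]) ^ 2 with hu
  have hu1 : PadicInt.toZMod u = 1 := by
    simp only [hu, map_mul, map_pow, map_intCast, map_natCast, hC, ha]
    linear_combination (a * b + 1) * hab
  obtain ⟨s, hs⟩ := Literature.NumberTheory.QuadraticForms.padicInt_isSquare_of_toZMod_eq_one hp2 hu1
  have hCq : ((C : ℕ) : ℚ_[p]) ≠ 0 := by exact_mod_cast hC0
  have hs' : ((n : ℤ) : ℚ_[p]) * ((C : ℕ) : ℚ_[p]) ^ 2 = (s : ℚ_[p]) * (s : ℚ_[p]) := by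
    have := congrArg ((↑) : ℤ_[p] → ℚ_[p]) hs
    push_cast [hu] at this
    exact this
  refine ⟨(s : ℚ_[p]) / ((C : ℕ) : ℚ_[p]), ?_⟩
  field_simp
  linear_combination hs'

/-- **`-4p` is not a square in `ℚ_p`** (its valuation `v_p(-4p)` is odd: `1` for odd `p`, `3` for `p = 2`). [cite: Serre1973, Ch. II §3.3 Thm 3 and Thm 4] -/
theorem not_isSquare_neg_four_mul_padic : ¬ IsSquare (((((0 : ℤ) : ℚ)) ^ 2 - 4 * ((p : ℕ) : ℚ) : ℚ) : ℚ_[p]) := by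
  have hpp := hp.out
  have hp1 : (1 : ℝ) < p := by exact_mod_cast hpp.one_lt
  rintro ⟨z, hz⟩
  have hq : ((((0 : ℤ) : ℚ)) ^ 2 - 4 * ((p : ℕ) : ℚ) : ℚ) = -(4 * p) := by push_cast; ring
  rw [hq] at hz
  have hz0 : z ≠ 0 := by
    intro h
    rw [h, mul_zero] at hz
    have : ((-(4 * p) : ℚ) : ℚ_[p]) = 0 := hz
    have h4 : (-(4 * p) : ℚ) ≠ 0 := by
      have : (p : ℚ) ≠ 0 := by exact_mod_cast hpp.ne_zero
      intro h0; apply this; linarith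
    exact h4 (by exact_mod_cast this)
  -- norms: `‖z‖² = ‖4p‖ = p^{-v_p(4p)}`
  have hn : ‖z‖ * ‖z‖ = (p : ℝ) ^ (-padicValRat p (4 * p)) := by
    rw [← norm_mul, ← hz, Padic.norm_eq_zpow_neg_valuation (by
      intro h; exact hz0 (by rw [h] at hz; exact zero_eq_mul_self.mp hz))]
    congr 1
    rw [Padic.valuation_ratCast, padicValRat.neg]
  rw [Padic.norm_eq_zpow_neg_valuation hz0, ← zpow_add₀ (by positivity)] at hn
  have hinj := zpow_right_injective₀ (by positivity) hp1.ne' hn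
  -- `v_p(4p) = v_p(4) + 1` is odd
  have hv : padicValRat p (4 * p) = padicValRat p 4 + 1 := by
    rw [padicValRat.mul (by norm_num) (by exact_mod_cast hpp.ne_zero), padicValRat.self hpp.one_lt]
  have h4 : padicValRat p (4 : ℚ) = if p = 2 then 2 else 0 := by
    split_ifs with h2
    · subst h2
      rw [show (4 : ℚ) = ((2 ^ 2 : ℕ) : ℚ) by norm_num, padicValRat.of_nat, padicValNat.prime_pow]
      norm_num
    · rw [show (4 : ℚ) = ((4 : ℕ) : ℚ) by norm_num, padicValRat.of_nat]
      have : ¬ p ∣ 4 := by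
        intro hd
        have : p ∣ 2 ^ 2 := by norm_num; exact hd
        exact h2 ((Nat.prime_dvd_prime_iff_eq hpp Nat.prime_two).mp (hpp.dvd_of_dvd_pow this))
      simp [padicValNat.eq_zero_of_not_dvd this]
  rw [hv, h4] at hinj
  split_ifs at hinj <;> omega

end Padic

/-! ## §2 Elements of reduced norm `p` in an order of `B_{p,∞}` have trace `0` (`p ≥ 5`) -/

section TraceZero

variable {M p : ℕ} [hp : Fact p.Prime] (S : XiSetup M p)

/-- **Voight's claim in the proof of Prop. 30.9.2**: «if `α ∈ O` has `nrd(α) = p`, then `trd(α) = 0`, i.e. `α² + p = 0`»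
(for `p ≥ 5`; `O` any order of the definite quaternion algebra of discriminant divisible by `p`): `t = trd α` is an integer with
`t² < 4p` (definiteness), and if `t ≠ 0` then `p ∤ t`, so `t² - 4p ≡ t² (mod p)` is a non-zero square and (Hensel) `ℚ(α) ⊗ ℚ_p`
splits — impossible since `B_p` is a division algebra. [cite: Voight2021, Prop. 30.9.2 (proof)] -/
theorem XiSetup.reducedTrace_eq_zero_of_reducedNorm_eq_prime (hp5 : 5 ≤ p) {O' : Submodule ℤ S.D} (hO' : IsOrder S.D O')
    {x : S.D} (hx : x ∈ O') (hn : reducedNorm ℚ S.D x = p) : reducedTrace ℚ S.D x = 0 := by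
  have hpp := hp.out
  have hp2 : p ≠ 2 := by omega
  haveI : Nontrivial S.D := Module.nontrivial_of_finrank_pos (R := ℚ)
    (by rw [IsQuaternionAlgebra.finrank_eq_four (K := ℚ) (D := S.D)]; norm_num)
  obtain ⟨t, n', ht, hn'⟩ := hO'.exists_int_reducedTrace_reducedNorm hx
  -- `x` is not a scalar (`nrd c = c² ≠ p`)
  have hxs : x ∉ (⊥ : Subalgebra ℚ S.D) := by
    intro h
    rw [Algebra.mem_bot] at h
    obtain ⟨c, rfl⟩ := h
    rw [reducedNorm_algebraMap] at hn
    -- `c² = p` with `c ∈ ℚ`: impossible (`v_p(c²)` is even, `v_p(p) = 1`)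
    have hc0 : c ≠ 0 := by
      rintro rfl
      have : (p : ℚ) = 0 := by rw [← hn]; ring
      exact hpp.ne_zero (by exact_mod_cast this)
    have hv := congrArg (padicValRat p) hn
    rw [padicValRat.pow, padicValRat.self hpp.one_lt] at hv
    push_cast at hv
    omega
  have hlt := reducedTrace_sq_lt_four_mul_reducedNorm S.isTotallyDefinite hxs
  rw [ht, hn] at hlt
  have hlt' : t ^ 2 < 4 * (p : ℤ) := by exact_mod_cast hlt
  -- `y = 2x - t` has `y² = t² - 4p`
  set y : S.D := (2 : ℚ) • x - (t : ℚ) • (1 : S.D) with hy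
  have hyy' : y * y = (((t : ℚ)) ^ 2 - 4 * p) • (1 : S.D) := by
    have hxx : x * x = reducedTrace ℚ S.D x • x - reducedNorm ℚ S.D x • (1 : S.D) := by
      rw [mul_self_eq_reducedTrace_mul_sub_reducedNorm ℚ S.D x, Algebra.algebraMap_eq_smul_one,
        Algebra.algebraMap_eq_smul_one, smul_mul_assoc, one_mul]
    rw [ht, hn] at hxx
    rw [hy]
    simp only [sub_mul, mul_sub, smul_mul_assoc, mul_smul_comm, one_mul, mul_one, hxx, smul_sub, smul_smul]
    module
  have hyy : y * y = algebraMap ℚ S.D ((t : ℚ) ^ 2 - 4 * p) := by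
    rw [hyy', Algebra.algebraMap_eq_smul_one]
  by_contra ht0
  have ht0' : t ≠ 0 := fun h => ht0 (by rw [ht, h, Int.cast_zero])
  -- `t² - 4p` is not a square in `ℚ_p` …
  have hns : ¬ IsSquare ((((t : ℚ) ^ 2 - 4 * p : ℚ)) : ℚ_[p]) := by
    refine S.not_isSquare_padic_of_mul_self_eq (dvd_refl p) ?_ hyy
    rintro ⟨r, hr⟩
    have : ((t : ℚ) ^ 2 - 4 * p : ℚ) < 0 := by exact_mod_cast (by linarith : (t ^ 2 - 4 * p : ℤ) < 0)
    nlinarith [mul_self_nonneg r]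
  -- … but it is congruent to the non-zero square `t²` modulo `p`
  apply hns
  have hpt : ¬ (p : ℤ) ∣ t := by
    intro hd
    obtain ⟨k, rfl⟩ := hd
    have hk : k ≠ 0 := by rintro rfl; exact ht0' (mul_zero _)
    have : (p : ℤ) ^ 2 * k ^ 2 < 4 * p := by nlinarith
    have hk1 : 1 ≤ k ^ 2 := by nlinarith [sq_nonneg k, Int.one_le_abs hk, sq_abs k]
    have hp5' : (5 : ℤ) ≤ p := by exact_mod_cast hp5
    nlinarith
  have hcast : ((((t : ℚ) ^ 2 - 4 * p : ℚ)) : ℚ_[p]) = (((t ^ 2 - 4 * p : ℤ)) : ℚ_[p]) := by push_cast; ring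
  rw [hcast]
  apply padic_isSquare_intCast hp2
  · rw [show ((t ^ 2 - 4 * p : ℤ) : ZMod p) = (t : ZMod p) ^ 2 by push_cast; simp]
    intro h0
    apply hpt
    have : ((t : ℤ) : ZMod p) = 0 := pow_eq_zero_iff (n := 2) (by norm_num) |>.mp h0
    exact (ZMod.intCast_zmod_eq_zero_iff_dvd t p).mp this
  · exact ⟨(t : ZMod p), by push_cast; simp [sq]⟩

/-- For `p ≥ 5` the elements of reduced norm `p` of the order `O_L(I_c)` are exactly its elements of trace `0` and norm `p`
(`traceNormSet I_c 0 p`). [cite: Voight2021, Prop. 30.9.2 (proof), (30.9.5)] -/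
theorem XiSetup.natCard_reducedNorm_eq_prime_eq_natCard_traceNormSet (hp5 : 5 ≤ p) (c : ClassSet S.O) :
    Nat.card {x : S.D // x ∈ leftOrder c.rep ∧ reducedNorm ℚ S.D x = p} =
      Nat.card (traceNormSet c.rep ((0 : ℤ) : ℚ) ((p : ℕ) : ℚ)) := by
  refine Nat.card_congr (Equiv.subtypeEquivProp ?_)
  ext x
  rw [mem_traceNormSet_iff, Int.cast_zero]
  constructor
  · rintro ⟨hx, hn⟩
    exact ⟨hx, S.reducedTrace_eq_zero_of_reducedNorm_eq_prime hp5 (S.isOrder_leftOrder_rep c) hx hn, hn⟩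
  · rintro ⟨hx, -, hn⟩
    exact ⟨hx, hn⟩

end TraceZero

/-! ## §3 The trace of `T(p)` for the maximal orders of `B_{p,∞}` -/

section Trace

variable {p : ℕ} [hp : Fact p.Prime]

/-- **The conductors of `X² + p`**: `ellipticConductors 0 p = {1}` if `p ≢ 3 (mod 4)`, `{1, 2}` if `p ≡ 3 (mod 4)` (the orders
`ℤ[√-p] ⊆ ℤ[(1+√-p)/2]`), for a prime `p`. [cite: Voight2021, Prop. 30.9.2 (proof, last paragraph)] -/
theorem mem_ellipticConductors_zero_prime_iff {f : ℕ} :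
    f ∈ ellipticConductors 0 p ↔ f = 1 ∨ (f = 2 ∧ p % 4 = 3) := by
  have hpp := hp.out
  have h0 : (0 : ℤ) ^ 2 < 4 * (p : ℕ) := by have := hpp.pos; push_cast; linarith
  rw [mem_ellipticConductors_iff h0]
  constructor
  · rintro ⟨hf, hdvd, hmod⟩
    have hdvd' : f ^ 2 ∣ 4 * p := by
      have : ((f ^ 2 : ℕ) : ℤ) ∣ ((4 * p : ℕ) : ℤ) := by
        have h1 : (f : ℤ) ^ 2 ∣ 4 * (p : ℤ) := by
          have := dvd_neg.mpr hdvd; simpa using this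
        exact_mod_cast h1
      exact_mod_cast this
    by_cases hf1 : f = 1
    · exact Or.inl hf1
    right
    have hf2 : f = 2 := by
      by_cases hpf : p ∣ f
      · -- then `p² ∣ 4p`, `p ∣ 4`, `p = 2`, `f² ∣ 8`
        have hp2 : p ∣ 4 := by
          have : p * p ∣ 4 * p := (pow_two p ▸ pow_dvd_pow_of_dvd hpf 2).trans hdvd'
          rw [mul_comm 4 p] at this
          exact Nat.dvd_of_mul_dvd_mul_left hpp.pos this
        have hp2' : p = 2 := (Nat.prime_dvd_prime_iff_eq hpp Nat.prime_two).mp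
          (hpp.dvd_of_dvd_pow (show p ∣ 2 ^ 2 by norm_num; exact hp2))
        subst hp2'
        have : f ^ 2 ∣ 8 := by norm_num at hdvd'; exact hdvd'
        have hle : f ^ 2 ≤ 8 := Nat.le_of_dvd (by norm_num) this
        have : f ≤ 2 := by nlinarith
        interval_cases f <;> simp_all
      · have hcop : Nat.Coprime (f ^ 2) p := (((Nat.Prime.coprime_iff_not_dvd hpp).mpr hpf).pow_right 2).symm
        have h4 : f ^ 2 ∣ 4 := hcop.dvd_of_dvd_mul_right hdvd'
        have hle : f ^ 2 ≤ 4 := Nat.le_of_dvd (by norm_num) h4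
        have : f ≤ 2 := by nlinarith
        interval_cases f <;> simp_all
    refine ⟨hf2, ?_⟩
    subst hf2
    have h4 : ¬ 4 ∣ p := fun h => by
      rcases (Nat.dvd_prime hpp).mp h with h | h
      · omega
      · rw [← h] at hpp; exact absurd hpp (by decide)
    norm_num at hmod
    omega
  · rintro (rfl | ⟨rfl, h3⟩)
    · exact ⟨one_pos, by simp, by push_cast; omega⟩
    · refine ⟨two_pos, ?_, ?_⟩
      · push_cast; exact ⟨-(p : ℤ), by ring⟩
      · push_cast; omega

/-- `(0 : ℤ)² < 4p`. [folklore] -/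
private theorem zero_sq_lt_four_mul : (0 : ℤ) ^ 2 < 4 * (p : ℕ) := by
  have := hp.out.pos; push_cast; linarith

/-- **The local embedding factor at the ramified prime is `1`** for the orders through `√-p`: `m_p(B_f) = 2 - ρ_p = 1` because
`p` divides the discriminant `-4p/f²` (`f = 1, 2`), and `fp` is never a conductor. [cite: Voight2021, Prop. 30.9.2 (proof: «K is ramified so m(S_p, O_p; O_p^×) = 1»)] [cite: VignerasLNM800, Ch. II §3] -/
theorem brFactorRam_zero_prime_eq_one (hp3 : p ≠ 2) {f : ℕ} (hf : f ∈ ellipticConductors 0 p) :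
    brFactorRam p 0 p f = 1 := by
  have hpp := hp.out
  unfold brFactorRam
  have hfp : f * p ∉ ellipticConductors 0 p := by
    rw [mem_ellipticConductors_zero_prime_iff]
    rintro (h | ⟨h, -⟩)
    · exact hpp.one_lt.ne' (Nat.eq_one_of_mul_eq_one_left h)
    · rcases mem_ellipticConductors_zero_prime_iff.mp hf with rfl | ⟨rfl, -⟩
      · rw [one_mul] at h; exact hp3 h
      · exact hpp.one_lt.ne' (by omega)
  rw [if_neg hfp]
  -- `p ∣ t_f² - 4 n_f = -4p/f²`
  have hdisc := sq_mul_disc (zero_sq_lt_four_mul (p := p)) hf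
  have hdvd : (p : ℤ) ∣ tOf 0 (p : ℕ) f ^ 2 - 4 * nOf 0 (p : ℕ) f := by
    rcases mem_ellipticConductors_zero_prime_iff.mp hf with rfl | ⟨rfl, -⟩
    · refine ⟨-4, ?_⟩; push_cast at hdisc ⊢; linarith
    · refine ⟨-1, ?_⟩; push_cast at hdisc ⊢; linarith
  rw [rho_eq_one_of_dvd hpp hdvd]
  norm_num

omit hp in
/-- `h_w((0² - 4p)/1²) = h_w(-4p)`. [folklore] -/
private theorem hw_zero_prime_one : hw 0 p 1 = weightedClassNumber (-(4 * (p : ℤ))) := by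
  unfold hw; congr 1; push_cast; omega

omit hp in
/-- `h_w((0² - 4p)/2²) = h_w(-p)`. [folklore] -/
private theorem hw_zero_prime_two : hw 0 p 2 = weightedClassNumber (-(p : ℤ)) := by
  unfold hw; congr 1; push_cast; omega

variable (S : XiSetup 1 p)

/-- The weights `w_c` of a setup are positive. [cite: Voight2021, 41.1.3] -/
private theorem XiSetup.weight_pos'' {Nplus Nminus : ℕ} (S : XiSetup Nplus Nminus) (c : ClassSet S.O) : 0 < weight S.O c :=
  S.weight_pos c (S.finite_units c)

/-- **The diagonal of the Brandt matrix through elements of norm `n`, over `ℚ`**: `T(n)_{cc} = #{x ∈ O_L(I_c) : nrd x = n} / #O_L(I_c)^×`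
(the tree's `two_mul_weight_mul_matrix_diag`, divided through in `ℚ`). [cite: Voight2021, (30.9.4) and 41.1.3] -/
theorem XiSetup.matrix_diag_eq_card_div_rat {Nplus Nminus : ℕ} (S : XiSetup Nplus Nminus) {n : ℕ} (hn : n ≠ 0) (c : ClassSet S.O) :
    (matrix S.O n c c : ℚ) = (Nat.card {x : S.D // x ∈ leftOrder c.rep ∧ reducedNorm ℚ S.D x = n} : ℚ) / (2 * weight S.O c) := by
  have h := S.two_mul_weight_mul_matrix_diag hn c
  have hw : (2 * weight S.O c : ℚ) ≠ 0 := by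
    have := S.weight_pos'' c; positivity
  rw [eq_div_iff hw]
  have := congrArg (fun z : ℤ => (z : ℚ)) h
  push_cast at this
  linarith

/-- **The trace of `T(p)` for the maximal orders of `B_{p,∞}` (`p ≥ 5`) is the optimal-embedding count of `√-p`**:
`tr T(p) = Σ_c #{x ∈ O_L(I_c) : trd x = 0, nrd x = p}/(2w_c) = ½ Σ_f h_w(-4p/f²) m_p(f)` (Eichler's trace formula at the
ramified prime, from the tree's `XiSetup.sum_card_traceNormSet_div_eq_sum_hw_br`). [cite: Voight2021, Prop. 30.9.2 (proof, (30.9.3)–(30.9.8))] [cite: VignerasLNM800, Ch. III §5 Thm. 5.11, Cor. 5.12] -/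
theorem XiSetup.trace_matrix_ramified_eq_sum_hw [Fintype (ClassSet S.O)] (hp5 : 5 ≤ p) :
    ∑ c, (matrix S.O p c c : ℚ) = (1 / 2 : ℚ) * ∑ f ∈ ellipticConductors 0 p, hw 0 p f * brFactorRam p 0 p f := by
  have hpp := hp.out
  -- an element `γ` with `γ² = -p` exists in `D` (`-4p` is not a `p`-adic square)
  obtain ⟨γ, hγt, hγn⟩ := S.exists_trace_norm_of_not_isSquare (zero_sq_lt_four_mul (p := p)) not_isSquare_neg_four_mul_padic
  have H : GammaHyp γ 0 p := ⟨S.hdiv, hγt, hγn, zero_sq_lt_four_mul⟩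
  have key := S.sum_card_traceNormSet_div_eq_sum_hw_br one_ne_zero squarefree_one hpp
    (fun h => hpp.one_lt.ne' (Nat.dvd_one.mp h)) H
  rw [Nat.primeFactors_one] at key
  simp only [Finset.prod_empty, one_mul] at key
  rw [← key]
  refine Finset.sum_congr rfl fun c _ => ?_
  rw [S.matrix_diag_eq_card_div_rat hpp.ne_zero, S.natCard_reducedNorm_eq_prime_eq_natCard_traceNormSet hp5]

/-- **THE TRACE OF `T(p)` (Eichler–Deuring): for the maximal orders of the definite quaternion algebra of prime discriminant
`p ≥ 5`, `tr T(p) = ½ (h(-4p) + [h(-p)])`**, where `[h(-p)] = h(-p)` if `p ≡ 3 (mod 4)` and `0` otherwise (`h` = the tree's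
`weightedClassNumber`, which is the class number for these discriminants `< -4`) — equivalently the number of ideal classes
`[I]` whose left order contains an element of reduced norm `p` (a square root of `-p`). [cite: Voight2021, Prop. 30.9.2 (proof) and 30.9.10] -/
theorem XiSetup.trace_matrix_ramified [Fintype (ClassSet S.O)] (hp5 : 5 ≤ p) :
    ∑ c, (matrix S.O p c c : ℚ) =
      (1 / 2 : ℚ) * (weightedClassNumber (-(4 * (p : ℤ))) + if p % 4 = 3 then weightedClassNumber (-(p : ℤ)) else 0) := by
  have hpp := hp.out
  have hp2 : p ≠ 2 := by omega
  rw [S.trace_matrix_ramified_eq_sum_hw hp5]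
  congr 1
  have hS : ellipticConductors 0 p = if p % 4 = 3 then ({1, 2} : Finset ℕ) else {1} := by
    ext f
    rw [mem_ellipticConductors_zero_prime_iff]
    split_ifs with h3 <;> simp [h3]
  rw [hS]
  split_ifs with h3
  · rw [Finset.sum_pair (by norm_num), brFactorRam_zero_prime_eq_one hp2, brFactorRam_zero_prime_eq_one hp2,
      hw_zero_prime_one, hw_zero_prime_two, mul_one, mul_one]
    · exact mem_ellipticConductors_zero_prime_iff.mpr (Or.inr ⟨rfl, h3⟩)
    · exact mem_ellipticConductors_zero_prime_iff.mpr (Or.inl rfl)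
  · rw [Finset.sum_singleton, brFactorRam_zero_prime_eq_one hp2 (mem_ellipticConductors_zero_prime_iff.mpr (Or.inl rfl)),
      hw_zero_prime_one, mul_one, add_zero]

end Trace


end Brandt

end Literature.NumberTheory.Automorphic
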